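import Summits.KontsevichZagierPeriods.KontsevichZagierPeriods.Theses.TerasomaMultiplication
import Summits.KontsevichZagierPeriods.KontsevichZagierPeriods.Theorems.CompleteModGammaSector.Negative.LoadBearing
import Literature.NumberTheory.Transcendental.KZCalculusProofs
import Literature.NumberTheory.Transcendental.KZLogCalculusProofs
import Literature.NumberTheory.Transcendental.SemialgebraicMapsProofs
import Literature.NumberTheory.Transcendental.SemialgebraicLineDeriv

/-!
# `CompleteModGammaSector` (stmt-KontsevichZagierPeriods-14233), line `Sketch` (card
# wronskian-transport): stub `stub_orderOneTransport`

The ENGINE of the line, analytic half (card `OrderOneTransport`): ONE Newton–Leibniz move of the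
Kontsevich–Zagier calculus IN THE PARAMETER. A band `r` over the base `r₁.domain` with constant
rational edges `q₀ ≤ q₁`, a `ℚ`-semialgebraic primitive `F` on the band (continuous on each closed
fibre, with fibre derivative the band integrand on the open fibre) and fibre representations
`r₀`, `r₁` pinned to `F(·, q₀)`, `F(·, q₁)` on the common base: if the band class `[r]` is a
relation, so is `[r₁] − [r₀]`. Proof: the difference representation
`D = [r₁.domain, r₁.integrand − r₀.integrand]` satisfies `[r] − [D] ∈ KZ.newtonLeibnizRel`
(rule (3) with the constant edges `q₀`, `q₁`), `[D] − [r₁] − [r₀.neg] ∈ KZ.integrandAddRel`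
(rule (1b)) and `[r₀] + [r₀.neg] ∈ relations`; combine in the free abelian group.
-/

noncomputable section

-- `Summit.KontsevichZagierPeriods.KontsevichZagierPeriods.…` is the tree's mandated layout (single-conjunct summit).
set_option linter.dupNamespace false

namespace Summit.KontsevichZagierPeriods.KontsevichZagierPeriods.CompleteModGammaSectorLine

open MeasureTheory Set
open Literature.NumberTheory.Transcendental
open Literature.NumberTheory.Transcendental.KZ
open Summit.KontsevichZagierPeriods.CompleteModGammaSectorNegative (gammaHodgePairs sector)

/-- **Order-one transport** (engine, analytic half; card `OrderOneTransport`): ONE Newton–Leibniz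
move in the parameter. A band `r` over the base `r₁.domain` with constant rational edges
`q₀ ≤ q₁`, a `ℚ`-semialgebraic primitive `F` on the band, continuous on each closed fibre and with
fibre derivative the band integrand on the open fibre, and fibre representations `r₀`, `r₁`
pinned to `F(·, q₀)`, `F(·, q₁)`: if the band class `[r]` is a relation (the fibrewise
certificate), then `[r₁] − [r₀]` is a relation. The difference representation
`D = [r₁.domain, r₁.integrand − r₀.integrand]` is reached from `[r]` by rule (3) with constant
edges, and `[D] ∼ [r₁] − [r₀]` by rule (1b). [cite: KontsevichZagier2001, §1.2 rule (3)] -/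
theorem stub_orderOneTransport :
    ∀ (n : ℕ) (q₀ q₁ : ℚ) (F : (Fin (n + 1) → ℝ) → ℝ)
      (r : IntegralRep (n + 1)) (r₀ r₁ : IntegralRep n),
      q₀ ≤ q₁ →
      r₀.domain = r₁.domain →
      r.domain = {z | (Fin.init z : Fin n → ℝ) ∈ r₁.domain ∧ ((q₀ : ℚ) : ℝ) ≤ z (Fin.last n) ∧
        z (Fin.last n) ≤ ((q₁ : ℚ) : ℝ)} →
      IsSemialgebraicFunOn ℚ r.domain F →
      (∀ x ∈ r₁.domain, ContinuousOn (fun t : ℝ => F (Fin.snoc x t)) (Set.Icc ((q₀ : ℚ) : ℝ) q₁)) →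
      (∀ x ∈ r₁.domain, ∀ t ∈ Set.Ioo ((q₀ : ℚ) : ℝ) q₁,
        HasDerivAt (fun s : ℝ => F (Fin.snoc x s)) (r.integrand (Fin.snoc x t)) t) →
      Set.EqOn r₀.integrand (fun x => F (Fin.snoc x q₀)) r₀.domain →
      Set.EqOn r₁.integrand (fun x => F (Fin.snoc x q₁)) r₁.domain →
      of r ∈ relations →
      of r₁ - of r₀ ∈ relations := by
  intro n q₀ q₁ F r r₀ r₁ hq hd hband hF hcont hderiv h₀ h₁ hr
  -- the fibre data of `r₀`, moved to the common base `r₁.domain`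
  have h0sa : IsSemialgebraicFunOn ℚ r₁.domain r₀.integrand :=
    hd ▸ r₀.isSemialgebraicFunOn_integrand
  have h0int : IntegrableOn r₀.integrand r₁.domain (volume : Measure (Fin n → ℝ)) :=
    hd ▸ r₀.integrableOn
  -- the difference representation `D = [r₁.domain, r₁.integrand - r₀.integrand]`
  obtain ⟨D, hDd, hDi⟩ : ∃ D : IntegralRep n, D.domain = r₁.domain ∧
      D.integrand = fun x => r₁.integrand x - r₀.integrand x :=
    ⟨{ domain := r₁.domain
       integrand := fun x => r₁.integrand x - r₀.integrand x
       isSemialgebraic_domain := r₁.isSemialgebraic_domain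
       isSemialgebraicFunOn_integrand := r₁.isSemialgebraicFunOn_integrand.fun_sub h0sa
       integrableOn := r₁.integrableOn.sub h0int }, rfl, rfl⟩
  -- (i) rule (3) in the parameter, constant edges `q₀ ≤ q₁`: `[r] - [D]` is a Newton–Leibniz move
  have hNL : of r - of D ∈ relations := by
    refine newtonLeibnizRel_subset_relations
      ⟨n, r, D, fun _ => ((q₀ : ℚ) : ℝ), fun _ => ((q₁ : ℚ) : ℝ), F, hF,
        isSemialgebraicFunOn_const_ratCast (hDd ▸ r₁.isSemialgebraic_domain) q₀,
        isSemialgebraicFunOn_const_ratCast (hDd ▸ r₁.isSemialgebraic_domain) q₁,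
        fun _ _ => Rat.cast_le.mpr hq, ?_, ?_, ?_, ?_, rfl⟩
    · rw [hDd]
      exact hband
    · rw [hDd]
      exact hcont
    · rw [hDd]
      exact hderiv
    · intro x hx
      rw [hDd] at hx
      have hx₀ : x ∈ r₀.domain := by
        rw [hd]
        exact hx
      show D.integrand x = F (Fin.snoc x ((q₁ : ℚ) : ℝ)) - F (Fin.snoc x ((q₀ : ℚ) : ℝ))
      simp only [hDi, h₁ hx, h₀ hx₀]
  -- (ii) rule (1b): `[D] - [r₁] - [r₀.neg]` is an integrand-additivity move
  have hAdd : of D - of r₁ - of r₀.neg ∈ relations := by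
    refine integrandAddRel_subset_relations ⟨n, D, r₁, r₀.neg, hDd.symm, ?_, ?_, rfl⟩
    · rw [IntegralRep.domain_neg, hd, hDd]
    · intro x _
      simp only [hDi, Pi.add_apply, IntegralRep.integrand_neg, Pi.neg_apply, sub_eq_add_neg]
  -- (iii) `[r₀] + [r₀.neg]` is a relation
  have hNeg : of r₀ + of r₀.neg ∈ relations :=
    levelRel_le_relations (of_add_of_neg_mem_levelRel r₀)
  have key : of r₁ - of r₀ =
      of r - (of r - of D) - (of D - of r₁ - of r₀.neg) - (of r₀ + of r₀.neg) := by
    abel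
  rw [key]
  exact relations.sub_mem (relations.sub_mem (relations.sub_mem hr hNL) hAdd) hNeg

end Summit.KontsevichZagierPeriods.KontsevichZagierPeriods.CompleteModGammaSectorLine
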